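import Literature.IUT.HodgeTheaters.PuncturedEllipticProLModelFrattiniXbar
import Literature.IUT.HodgeTheaters.PuncturedEllipticProLModelModL
import HarnessLib

/-!
# An infinite pro-`l` model of [IUTchI] §1, part 12: lines in general position — the arc functionals

Mochizuki, *Inter-universal Teichmüller theory I*, kurims manuscript (May 2020), §1 p. 37 l. 30–36: "`Δ_X̲ ↠ Δ_X̲^{ab} ⊗
(ℤ/lℤ) ↠ Δ_ε` … the cuspidal inertia groups … `0 → I_ε′ × I_ε″ → Δ_ε` … `I_ε′ ≅ ℤ/lℤ`" ([IUTchI] §1 p.37)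
[claim: Mochizuki2012, status: disputed] (D-0012 claim key; series status DISPUTED — PROOF-ONLY module; nothing of the
series is asserted, no side is taken on [IUTchIII] Cor. 3.12).

Cell abc-iut, seat abc-iut-L5-d4, row R45 «COR12-MODL-LAWS-DERIVE@M_l», brick B4a.  In the pro-`l` model `P`
(parts 1–10) the `l` inertia lines `D_k = ℤ_l · c_k`, `c_k = B_{k+1} − B_k`, of `Π_X̲ = N × lℤ_l` satisfy the single
relation `Σ_k c_k = 0` modulo `Ker := Ker(Π_X̲ ↠ Π_X̲^{ab} ⊗ ℤ/l)`; this file proves the two consequences needed to read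
the printed sentences (L2a) (L2c) off the shadow of a genuine datum whose cusp labels land in GENERAL position (an
arbitrary family `κ : ι → ℤ/l` of killed labels and two further labels `k ≠ m` outside it):
* `arcSum_cvec` — the ARC FUNCTIONAL `v ↦ Σ_{n<L} v(m+1+n)` on `N` takes the value `[j = m] − [j = m+L]` on `c_j`
  (telescoping), so it kills every line except `D_m` and `D_{m+L}` (`toZMod_arcSum_of_mem_sup`);
* **`line_inf_sup_le_modLKer`** — `D_k ∩ (Ker · ∏_{i} D_{κ i}) ⊆ Ker` whenever some label `m ≠ k` is missed by `κ` and
  `k` is missed by `κ` (general-position (L2c));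
* **`relIndex_line_sup`** — `[D_k · Ker · ∏_i D_{κ i} : Ker · ∏_i D_{κ i}] = l` under the same hypotheses
  (general-position (L2a)).
HONEST LABEL: derivation device over OUR interfaces (the `Δ_X̲`-abelian shadow); no `sorry`; symbolic prime `l`.
-/

noncomputable section

namespace Literature.IUT.HodgeTheaters

namespace PuncturedEllipticData

namespace ProLModel

open DihedralGroup _root_.Topology Literature.AnabelianGeometry.AbsoluteAnabelian
open scoped Pointwise

variable (l : ℕ) [Fact l.Prime]

/-- Local copy of the divisibility step `t ≡ 0 (mod l) ⇒ t = l·t′`. [claim: Mochizuki2012, status: disputed] -/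
private theorem exists_eq_mul_of_toZMod_eq_zero'' {x : ℤ_[l]} (hx : PadicInt.toZMod x = 0) :
    ∃ t : ℤ_[l], x = l * t := by
  have hx' : x ∈ RingHom.ker (PadicInt.toZMod (p := l)) := hx
  rw [PadicInt.ker_toZMod, PadicInt.maximalIdeal_eq_span_p, Ideal.mem_span_singleton'] at hx'
  obtain ⟨t, ht⟩ := hx'
  exact ⟨t, by rw [← ht, mul_comm]⟩

/-- Local copy: in a join of two elementwise commuting subgroups every element is a product.
[claim: Mochizuki2012, status: disputed] -/
private theorem exists_mul_eq_of_mem_sup' {G : Type*} [Group G] {H K : Subgroup G}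
    (hc : ∀ h ∈ H, ∀ k ∈ K, h * k = k * h) {x : G} (hx : x ∈ H ⊔ K) : ∃ h ∈ H, ∃ k ∈ K, h * k = x := by
  rw [Subgroup.sup_eq_closure] at hx
  induction hx using Subgroup.closure_induction with
  | mem y hy =>
    rcases hy with hy | hy
    · exact ⟨y, hy, 1, K.one_mem, mul_one y⟩
    · exact ⟨1, H.one_mem, y, hy, one_mul y⟩
  | one => exact ⟨1, H.one_mem, 1, K.one_mem, mul_one 1⟩
  | mul y z _ _ hy hz =>
    obtain ⟨h₁, hh₁, k₁, hk₁, rfl⟩ := hy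
    obtain ⟨h₂, hh₂, k₂, hk₂, rfl⟩ := hz
    refine ⟨h₁ * h₂, H.mul_mem hh₁ hh₂, k₁ * k₂, K.mul_mem hk₁ hk₂, ?_⟩
    calc h₁ * h₂ * (k₁ * k₂) = h₁ * (h₂ * k₁) * k₂ := by group
      _ = h₁ * (k₁ * h₂) * k₂ := by rw [hc h₂ hh₂ k₁ hk₁]
      _ = h₁ * k₁ * (h₂ * k₂) := by group
  | inv y _ hy =>
    obtain ⟨h, hh, k, hk, rfl⟩ := hy
    refine ⟨h⁻¹, H.inv_mem hh, k⁻¹, K.inv_mem hk, ?_⟩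
    rw [mul_inv_rev, hc h⁻¹ (H.inv_mem hh) k⁻¹ (K.inv_mem hk)]

/-! ### The arc sums -/

/-- The arc sum is `ℤ_l`-linear. [claim: Mochizuki2012, status: disputed] -/
theorem arcSum_smul (m : ZMod l) (L : ℕ) (t : ℤ_[l]) (v : V l) :
    ∑ n ∈ Finset.range L, (t • v) (m + 1 + n) = t * ∑ n ∈ Finset.range L, v (m + 1 + n) := by
  simp only [Pi.smul_apply, smul_eq_mul, Finset.mul_sum]

/-- The arc sum is additive. [claim: Mochizuki2012, status: disputed] -/
theorem arcSum_add (m : ZMod l) (L : ℕ) (v w : V l) :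
    ∑ n ∈ Finset.range L, (v + w) (m + 1 + n) =
      ∑ n ∈ Finset.range L, v (m + 1 + n) + ∑ n ∈ Finset.range L, w (m + 1 + n) := by
  simp only [Pi.add_apply, Finset.sum_add_distrib]

/-- **The arc sum of an inertia vector (telescoping)**: `Σ_{n<L} c_j(m+1+n) = [j = m] − [j = m+L]` — the ARC
FUNCTIONAL `v ↦ Σ_{n<L} v(m+1+n)` kills every line `D_j` except `D_m` and `D_{m+L}`. [claim: Mochizuki2012, status: disputed] -/
theorem arcSum_cvec (m j : ZMod l) (L : ℕ) :
    ∑ n ∈ Finset.range L, cvec l j (m + 1 + n) = (if m = j then 1 else 0) - (if m + (L : ZMod l) = j then 1 else 0) := by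
  have h : ∀ n : ℕ, cvec l j (m + 1 + n) =
      (fun n : ℕ => if m + (n : ZMod l) = j then (1 : ℤ_[l]) else 0) n -
        (fun n : ℕ => if m + (n : ZMod l) = j then (1 : ℤ_[l]) else 0) (n + 1) := by
    intro n
    have e1 : (m + 1 + (n : ZMod l) = j + 1) ↔ (m + n = j) := by
      constructor <;> intro h <;> linear_combination h
    have e2 : (m + 1 + (n : ZMod l) = j) ↔ (m + ((n + 1 : ℕ) : ZMod l) = j) := by
      rw [Nat.cast_succ]; constructor <;> intro h <;> linear_combination h
    simp only [cvec_apply, e1, e2]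
  simp_rw [h]
  rw [Finset.sum_range_sub']
  simp only [Nat.cast_zero, add_zero]

/-- The arc sum of `t · c_{m+L}` is `−t` (for `m ≠ m + L`). [claim: Mochizuki2012, status: disputed] -/
theorem arcSum_smul_cvec_end {m : ZMod l} {L : ℕ} (hL : m ≠ m + (L : ZMod l)) (t : ℤ_[l]) :
    ∑ n ∈ Finset.range L, (t • cvec l (m + (L : ZMod l))) (m + 1 + n) = -t := by
  rw [arcSum_smul, arcSum_cvec, if_neg hL, if_pos rfl, zero_sub, mul_neg, mul_one]

/-- The arc length from `m` to `k`: `m + L = k` for `L := (k − m).val`. [claim: Mochizuki2012, status: disputed] -/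
theorem add_val_sub_eq (k m : ZMod l) : m + (((k - m).val : ℕ) : ZMod l) = k := by
  haveI : NeZero l := ⟨(Fact.out : l.Prime).ne_zero⟩
  rw [ZMod.natCast_zmod_val, add_sub_cancel]

/-- `Ker · ∏_i D_{κ i} ⊆ Π_X̲`. [claim: Mochizuki2012, status: disputed] -/
theorem sup_le_PiXbar (h5 : 5 ≤ l) {ι : Type*} (κ : ι → ZMod l) :
    (datum l h5).modLKer ⊔ ⨆ i, Dm l (κ i) ≤ PiXm l ⊓ PiCbarm l :=
  sup_le (fun g hg => ((mem_modLKer_datum_iff l h5 g).1 hg).1) (iSup_le fun i => Dm_le_PiXbar l (κ i))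

/-- **The arc functional mod `l` kills `Ker · ∏_i D_{κ i}`** when `κ` misses `m` and `m + L`: the elements of `Π_X̲`
with arc sum `≡ 0 (mod l)` form a subgroup containing `Ker(Π_X̲ ↠ Π_X̲^{ab} ⊗ ℤ/l)` (its `N`-components lie in `l·N`)
and every line `D_j`, `j ∉ {m, m+L}`. [claim: Mochizuki2012, status: disputed] -/
theorem toZMod_arcSum_of_mem_sup (h5 : 5 ≤ l) {ι : Type*} (κ : ι → ZMod l) {m : ZMod l} {L : ℕ}
    (hm : ∀ i, κ i ≠ m) (hL : ∀ i, κ i ≠ m + (L : ZMod l)) {g : P l}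
    (hg : g ∈ (datum l h5).modLKer ⊔ ⨆ i, Dm l (κ i)) :
    PadicInt.toZMod (∑ n ∈ Finset.range L, Multiplicative.toAdd g.left (m + 1 + n)) = 0 := by
  let K : Subgroup (P l) :=
    { carrier := {g | g ∈ PiXm l ⊓ PiCbarm l ∧
        PadicInt.toZMod (∑ n ∈ Finset.range L, Multiplicative.toAdd g.left (m + 1 + n)) = 0}
      one_mem' := ⟨Subgroup.one_mem _, by
        simp only [SemidirectProduct.one_left, toAdd_one, Pi.zero_apply, Finset.sum_const_zero, map_zero]⟩
      mul_mem' := fun {a b} ha hb => ⟨Subgroup.mul_mem _ ha.1 hb.1, by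
        rw [left_mul_of_mem_PiXbar l ha.1, toAdd_mul, arcSum_add, map_add, ha.2, hb.2, add_zero]⟩
      inv_mem' := fun {a} ha => ⟨Subgroup.inv_mem _ ha.1, by
        have h := left_mul_of_mem_PiXbar l (Subgroup.inv_mem _ ha.1) a
        rw [inv_mul_cancel, SemidirectProduct.one_left] at h
        have h' : Multiplicative.toAdd a⁻¹.left = -Multiplicative.toAdd a.left := by
          rw [eq_neg_iff_add_eq_zero, ← toAdd_mul, ← h, toAdd_one]
        rw [h']
        simp only [Pi.neg_apply, Finset.sum_neg_distrib, map_neg, ha.2, neg_zero]⟩ }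
  have hKmem : ∀ x, x ∈ K ↔ x ∈ PiXm l ⊓ PiCbarm l ∧
      PadicInt.toZMod (∑ n ∈ Finset.range L, Multiplicative.toAdd x.left (m + 1 + n)) = 0 := fun x => Iff.rfl
  have hΦ : (datum l h5).modLKer ≤ K := fun x hx => by
    obtain ⟨hW, hleft, -⟩ := (mem_modLKer_datum_iff l h5 x).1 hx
    refine (hKmem x).2 ⟨hW, ?_⟩
    rw [map_sum]
    exact Finset.sum_eq_zero fun n _ => hleft _
  have hD : ∀ i, Dm l (κ i) ≤ K := fun i => by
    rintro _ ⟨s, rfl⟩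
    refine (hKmem _).2 ⟨Dm_le_PiXbar l _ ⟨s, rfl⟩, ?_⟩
    rw [inertiaHom_apply, inN_left, toAdd_ofAdd, arcSum_smul, arcSum_cvec, if_neg (hm i).symm, if_neg (hL i).symm,
      sub_zero, mul_zero, map_zero]
  exact (((hKmem g).1 ((sup_le hΦ (iSup_le hD)) hg))).2

/-! ### General-position (L2c): `D_k ∩ (Ker · ∏_i D_{κ i}) ⊆ Ker` -/

/-- **General-position (L2c) in the model.**  If the family of labels `κ` misses two distinct labels `k, m`, then
`D_k ∩ (Ker · ∏_i D_{κ i}) ⊆ Ker = Ker(Π_X̲ ↠ Π_X̲^{ab} ⊗ ℤ/l)`: the arc functional from `m` to `k` kills the join and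
is `t ↦ −t` on `D_k = {t · c_k}`. ([IUTchI] §1 p.37 "`0 → I_ε′ × I_ε″ → Δ_ε`") [claim: Mochizuki2012, status: disputed] -/
theorem line_inf_sup_le_modLKer (h5 : 5 ≤ l) {ι : Type*} (κ : ι → ZMod l) {k m : ZMod l} (hkm : k ≠ m)
    (hk : ∀ i, κ i ≠ k) (hm : ∀ i, κ i ≠ m) :
    Dm l k ⊓ ((datum l h5).modLKer ⊔ ⨆ i, Dm l (κ i)) ≤ (datum l h5).modLKer := by
  set L : ℕ := (k - m).val with hLdef
  have hmL : m + (L : ZMod l) = k := add_val_sub_eq l k m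
  rintro g ⟨⟨s, rfl⟩, hg⟩
  have h2 := toZMod_arcSum_of_mem_sup l h5 κ hm (fun i => by rw [hmL]; exact hk i) hg
  rw [inertiaHom_apply, inN_left, toAdd_ofAdd] at h2
  have ht : PadicInt.toZMod (Multiplicative.toAdd s) = 0 := by
    rw [← hmL, arcSum_smul_cvec_end l (by rw [hmL]; exact Ne.symm hkm), map_neg, neg_eq_zero] at h2
    exact h2
  rw [inertiaHom_apply]
  exact inN_smul_cvec_mem_modLKer l h5 ht k

/-! ### General-position (L2a): `[D_k · Ker · ∏_i D_{κ i} : Ker · ∏_i D_{κ i}] = l` -/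

/-- **General-position (L2a) in the model.**  If `κ` misses two distinct labels `k, m`, then
`[D_k · E : E] = l` for `E := Ker · ∏_i D_{κ i}`: the arc functional from `m` to `k`, reduced mod `l`, is a surjection
`D_k · E ↠ ℤ/l` with kernel `E`. ([IUTchI] §1 p.37 "`I_ε′ ≅ ℤ/lℤ`") [claim: Mochizuki2012, status: disputed] -/
theorem relIndex_line_sup (h5 : 5 ≤ l) {ι : Type*} (κ : ι → ZMod l) {k m : ZMod l} (hkm : k ≠ m)
    (hk : ∀ i, κ i ≠ k) (hm : ∀ i, κ i ≠ m) :
    ((datum l h5).modLKer ⊔ ⨆ i, Dm l (κ i)).relIndex (Dm l k ⊔ ((datum l h5).modLKer ⊔ ⨆ i, Dm l (κ i))) = l := by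
  classical
  set L : ℕ := (k - m).val with hLdef
  have hmL : m + (L : ZMod l) = k := add_val_sub_eq l k m
  have hmk : m ≠ m + (L : ZMod l) := by rw [hmL]; exact Ne.symm hkm
  have hL : ∀ i, κ i ≠ m + (L : ZMod l) := fun i => by rw [hmL]; exact hk i
  set E := (datum l h5).modLKer ⊔ ⨆ i, Dm l (κ i) with hE
  set A := Dm l k ⊔ E with hA
  have hEW : E ≤ PiXm l ⊓ PiCbarm l := sup_le_PiXbar l h5 κ
  have hAW : A ≤ PiXm l ⊓ PiCbarm l := sup_le (Dm_le_PiXbar l k) hEW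
  -- the arc character on `A`
  let f : A →* Multiplicative (ZMod l) := MonoidHom.mk'
    (fun x => Multiplicative.ofAdd (PadicInt.toZMod
      (∑ n ∈ Finset.range L, Multiplicative.toAdd x.1.left (m + 1 + n))))
    (fun x y => by
      rw [← ofAdd_add, Subgroup.coe_mul, left_mul_of_mem_PiXbar l (hAW x.2), toAdd_mul, arcSum_add, map_add])
  have hf : ∀ x : A, f x = 1 ↔
      PadicInt.toZMod (∑ n ∈ Finset.range L, Multiplicative.toAdd x.1.left (m + 1 + n)) = 0 := fun x => Iff.rfl
  have hker : f.ker = E.subgroupOf A := by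
    ext x
    rw [MonoidHom.mem_ker, Subgroup.mem_subgroupOf, hf]
    constructor
    · intro hx
      have hcomm : ∀ a ∈ Dm l k, ∀ b ∈ E, a * b = b * a := fun a ha b hb =>
        commute_of_mem_PiXbar l (Dm_le_PiXbar l k ha) (hEW hb)
      obtain ⟨a, ha, b, hb, hab⟩ := exists_mul_eq_of_mem_sup' hcomm x.2
      obtain ⟨s, rfl⟩ := ha
      have hbker := toZMod_arcSum_of_mem_sup l h5 κ hm hL hb
      rw [← hab, left_mul_of_mem_PiXbar l (Dm_le_PiXbar l k ⟨s, rfl⟩), toAdd_mul, arcSum_add, map_add, hbker,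
        add_zero, inertiaHom_apply, inN_left, toAdd_ofAdd, ← hmL, arcSum_smul_cvec_end l hmk, map_neg,
        neg_eq_zero] at hx
      rw [← hab, inertiaHom_apply]
      exact E.mul_mem (Subgroup.mem_sup_left (inN_smul_cvec_mem_modLKer l h5 hx _)) hb
    · intro hx
      exact toZMod_arcSum_of_mem_sup l h5 κ hm hL hx
  have hsurj : Function.Surjective f := by
    intro c
    have hmem : inN l ((-((Multiplicative.toAdd c).val : ℤ_[l])) • cvec l k) ∈ A :=
      Subgroup.mem_sup_left ⟨Multiplicative.ofAdd _, by rw [inertiaHom_apply, toAdd_ofAdd]⟩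
    refine ⟨⟨_, hmem⟩, ?_⟩
    change Multiplicative.ofAdd (PadicInt.toZMod (∑ n ∈ Finset.range L, Multiplicative.toAdd
      (inN l ((-((Multiplicative.toAdd c).val : ℤ_[l])) • cvec l k)).left (m + 1 + n))) = c
    rw [inN_left, toAdd_ofAdd, ← hmL, arcSum_smul_cvec_end l hmk, neg_neg, map_natCast, ZMod.natCast_zmod_val,
      ofAdd_toAdd]
  change E.relIndex A = l
  rw [Subgroup.relIndex, ← hker, Subgroup.index_ker, MonoidHom.range_eq_top.mpr hsurj, Subgroup.card_top,
    Nat.card_eq_fintype_card, Fintype.card_multiplicative, ZMod.card]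

end ProLModel

end PuncturedEllipticData

end Literature.IUT.HodgeTheaters
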